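import Summits.QuantumFields.BalabanUV.Gaps.CapBlockTowerWindow
import Summits.QuantumFields.BalabanUV.Gaps.CapBlockTowerEmpty
import Summits.QuantumFields.BalabanUV.Beta.GAN24.WSlotT2TablesAn1

/-!
# Gaps / CapBlockTowerDrift — the block tower on the (D1) DRIFT road and AT THE PINNED LITERAL: the WALL statement `D1Drift` gives
# Theorem-2 grade up the tower with NO budget and NO CAP, and for the β-lead's literal `JsBalAn1` (whose all-scales rate is hypothesis-free in
# the tree) the only β-side input of the tower road is `0 < lim_j β⁰_j` (cell pub-balaban-gaps, seat g1-p3 gen 5, CAP+tail «split ∕ weakening»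
# charge; fourth leaf of the block-tower series after `CapBlockTowerEmpty` (rate), `CapBlockTowerWashout` (eventual rate ∕ floor),
# `CapBlockTowerWindow` (window currency))

HONEST FRAMING (cell rule, page 1 of everything): bookkeeping over hypothesis SHAPES and typed objects of the tree's β sub-cell; NOTHING of
Bałaban's is asserted beyond print; [Balaban1987RG1] Thm 2 is UNPROVED IN PRINT and enters only as the conclusion `B12.Thm2Printed C L`; the
drift `OneLoopDrift b A β0` ∕ `D1Drift Lc Js N μ ν` is the β sub-cell's WALL statement (EXIT-A∕B of `OneStepKernelFamily`; OPEN — nothing here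
proves it); the positivity `0 < lim_j β⁰_j` for the pinned literal is the IDENTIFICATION residual of row (D1) ((P6)∕(W-L-2)) in its weakest
form — OPEN; the ONE-SIDED one-loop composition hypothesis `blockSum n b k ≤ S.β0 k` (Q-asym1-5; g1-plan-2 L-1 ∕ X-79 (b)) is a BINDER; (D4)
enters as `EverySlope` ∕ `LimitForm` for the big construction; READING CLAUSE (W-KKT-2) as in the `JsBal` leaves: the identification of the
`μ ≠ ν` second moment of `TbalOf Lc (JsBalAn1 …) j` with Bałaban's printed (1.22) coefficient is the sub-cell's READING, not asserted; the
provisional units (P6′) inside an2's definitions are by name; 0 coefficients certified; 0∕6 binders discharged; one finite T⁴; NOT `BetaPertH`,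
NOT the continuum limit, NOT Clay.  HONEST DEPENDENCY (b2b cell, verbatim): «continuum YM on T⁴ ⇐ BetaPertH ∧ nine spine estimates (0/9
proved); BetaPertH ⇐ (D1) ∧ (D4) ∧ CAP+tail; G-an2-4 gates asym, D1 and NE2/3/4.»

THE POINT ([folklore] sequence algebra + the tree's own theorems BY NAME).
§1 DRIFT ⟹ TOWER, NO BUDGET: `OneLoopDrift b A β0` is a window floor with slope `b` and defect `2A` (`Beta.Drift.sum_Ico_ge_of_drift`), hence
   (`CapBlockTowerWindow`) every block sum at power `n` is `≥ b·n − 2A`, positive from `n ≥ ⌊2A∕b⌋₊ + 1` when `0 < b`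
   (`blockSums_of_drift_index_le`).  Compare gen 4's FIXED-block-size road `CapFreeLargeL.thm2Printed_of_drift_oneL`, which needs the SHARP
   BUDGET `2A < b` (`drift_allows_nonpos`): along the tower ANY defect `A` is absorbed by the power.  SHARP: if `b·n ≤ 2A` the drift allows a
   nonpositive block sum at power `n` (`drift_allows_nonpos_blockSum`).
§2 ENDs: **`thm2Printed_of_blockTowerDrift_everySlope`** (drift of the SMALL-block coefficients, `0 < b`, power `≥ ⌊2A∕b⌋₊ + 1`, one-sided
   composition, `EverySlope` + (C)(U) of the big construction, forward generation ⟹ `B12.Thm2Printed C L'`), `_limitForm`; in the β sub-cell's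
   typed currency **`thm2Printed_of_blockTower_D1Drift`**: the WALL statement `D1Drift Lc Js N μ ν` for ANY step-jet family `Js` (slope
   `stepBal N Lc`, which is `> 0` as a hypothesis `hstep`) ⟹ (0.31) for every big construction whose one-loop coefficients dominate the block
   sums of `j ↦ secondMoment (TbalOf Lc Js j) μ ν`, from an explicit power on — at a FIXED block size the wall gives only END grade
   (`OneStepKernelFamily.endpointExistence_of_D1Drift`) unless the budget `2A < stepBal N Lc` holds.
§3 THE PINNED LITERAL `JsBalAn1` (β-lead WALL v2.21; K∕S∕W slots closed, `GAN24.WSlotT2TablesAn1.allScalesSeq_secondMoment_JsBalAn1_pinned`: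
   `∃ κ θ, 0 ≤ θ < 1 ∧ AllScalesSeq (j ↦ β⁰_j) κ θ` with NO hypothesis beyond `2 ≤ Lc`, the box root and the colour constants ∕ table by value):
   **`towerPower_of_pinned_limPos`** — `0 < CauchyRate.lim (j ↦ β⁰_j)` ALONE ⟹ `∃ N, ∀ n ≥ N, ∀ k, 0 < blockSum n (j ↦ β⁰_j) k` (all-scales ⟹
   Cauchy ⟹ `GeomRate` with limit `lim` ⟹ `CapBlockTowerEmpty`); and **`thm2Printed_of_blockTower_pinned`**: the corresponding END for every
   big construction with the one-sided composition w.r.t. the literal's coefficients.  So at the pinned literal the tower road's ONLY β-side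
   input is the SIGN OF THE LIMIT — weaker than the wall (`D1Drift` = partial sums within `A` of the line with the printed slope) and than
   any certified coefficient; the power `N` is NOT a number (κ, θ sit inside an `∃`; row tail: «numeric n₀ unreachable via road P1's constants»).
§4 NECESSITY UP THE TOWER (with `hblock` as an EQUALITY): `B12.Thm2Printed` for the big construction at ANY power `n ≥ 1` forces `0 < β⁰_∞`
   (`binf_pos_of_thm2Printed_tower`, via gen 3's `eventualFloor_of_thm2Printed_tendsto_fwd`), so at a high power `B12.Thm2Printed C L' ↔ 0 < β⁰_∞`
   (`thm2Printed_tower_iff_binf_pos`), and at the pinned literal `B12.Thm2Printed` forces `0 < lim β⁰_j` (`limPos_of_thm2Printed_pinned`): the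
   sign of the limit is EXACTLY the β-side content of Theorem 2 up the tower.
READING for rows (D1) ∕ CAP ∕ tail and the (M)∕CA-1 decision: on the Q-asym1-5 road, Theorem-2 grade for the high powers of the pinned
literal's block size needs from the β-side exactly `0 < lim β⁰_j` (the identification residual of row (D1) in sign form) — no CAP, no budget,
no certified coefficient; the price sits in Q-asym1-5 (one-sided) and (D4)∕(C) of the big construction.  0 sorry; 0 def; imports tree files only.

CITATION HEADER (tags CONTEXT ONLY).  [I] = T. Bałaban, Commun. Math. Phys. **109** (1987) [Balaban1987RG1]: Thm 2 p. 259 with (0.31); (1.22)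
p. 264; (2.12)–(2.14) p. 268; (0.20) p. 256 (the printed one-loop step, `B12Normalization.stepBal`).
-/

namespace Summit.QuantumFields.BalabanUV.Gaps.CapBlockTowerDrift

open Literature.MathematicalPhysics.QuantumFieldTheory.Balaban1983to89
open Literature.MathematicalPhysics.QuantumFieldTheory.Balaban1983to89.FlowStep
open Literature.MathematicalPhysics.QuantumFieldTheory.Balaban1983to89.FlowStepRuns
open Literature.MathematicalPhysics.QuantumFieldTheory.Balaban1983to89.DagBinding
open Literature.MathematicalPhysics.QuantumFieldTheory.Balaban1983to89.Beta
open Literature.MathematicalPhysics.QuantumFieldTheory.Balaban1983to89.Beta.RateCertificate (GeomRate CauchyRate blockSum)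
open Literature.MathematicalPhysics.QuantumFieldTheory.Balaban1983to89.Beta.Drift (OneLoopDrift sum_Ico_ge_of_drift)
open Literature.MathematicalPhysics.QuantumFieldTheory.Balaban1983to89.Beta.RemainderConstAllScales (AllScalesSeq)
open Literature.MathematicalPhysics.QuantumFieldTheory.Balaban1983to89.Beta.OneStepResolventKernel (JetData)
open Literature.MathematicalPhysics.QuantumFieldTheory.Balaban1983to89.Beta.OneStepKernelFamily (TbalOf D1Drift)
open Literature.MathematicalPhysics.QuantumFieldTheory.Balaban1983to89.Beta.AffineAveraging (box)
open Summit.QuantumFields.BalabanUV.Gaps.CapSignsConstRoad (EverySlope thm2Printed_of_beta0Floor_everySlope)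
open Summit.QuantumFields.BalabanUV.Gaps.CapBlockTowerWindow (blockSums_of_windowFloor_index_le)
open Summit.QuantumFields.BalabanUV.Gaps.CapBlockTowerEmpty (blockSums_towerFloor_of_index_le)
open Summit.QuantumFields.BalabanUV.Beta.MixedJetTablesPlug (JsBalAn1)
open Summit.QuantumFields.BalabanUV.Beta.GAN24.WSlotT2TablesAn1 (allScalesSeq_secondMoment_JsBalAn1_pinned)
open Summit.QuantumFields.BalabanUV.Beta.GAN24.StencilSlotOfE3 (one_le_of_two_le)
open Finset

noncomputable section

/-! ## §1 Drift ⟹ tower, no budget -/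

/-- **A DRIFT IS A WINDOW FLOOR**: `OneLoopDrift b A β0` ⟹ `∀ k n, b·n − 2A ≤ Σ_{[k,k+n)} β0` (`Beta.Drift.sum_Ico_ge_of_drift`, re-indexed).
[folklore] -/
theorem windowFloor_of_drift {b A : ℝ} {β0 : ℕ → ℝ} (h : OneLoopDrift b A β0) :
    ∀ k n : ℕ, b * n - 2 * A ≤ ∑ j ∈ Ico k (k + n), β0 j := fun k n => by
  have h1 := sum_Ico_ge_of_drift h (Nat.le_add_right k n)
  push_cast at h1
  have e : b * (((k : ℝ) + n) - k) = b * n := by ring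
  linarith [e ▸ h1]

/-- **DRIFT ⟹ ALL BLOCK SUMS POSITIVE FROM THE POWER `⌊2A∕b⌋₊ + 1` ON** (`0 < b`; floor `b·n − 2A`) — no budget `2A < b`, no sign, no rate.
[folklore] -/
theorem blockSums_of_drift_index_le {b A : ℝ} {β0 : ℕ → ℝ} (h : OneLoopDrift b A β0) (hb : 0 < b) {n : ℕ}
    (hn : ⌊2 * A / b⌋₊ + 1 ≤ n) : 0 < b * n - 2 * A ∧ ∀ k, b * n - 2 * A ≤ blockSum n β0 k :=
  blockSums_of_windowFloor_index_le hb (windowFloor_of_drift h) hn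

/-- Pure existence: a drift with positive slope ⟹ some power from which on all block sums are positive. [folklore] -/
theorem exists_towerPower_of_drift {b A : ℝ} {β0 : ℕ → ℝ} (h : OneLoopDrift b A β0) (hb : 0 < b) :
    ∃ N : ℕ, ∀ n, N ≤ n → ∀ k, 0 < blockSum n β0 k :=
  ⟨⌊2 * A / b⌋₊ + 1, fun n hn k => by
    obtain ⟨hpos, hF⟩ := blockSums_of_drift_index_le h hb hn
    exact hpos.trans_le (hF k)⟩

/-- **SHARPNESS**: if `b·n ≤ 2A` (`0 ≤ A`, `1 ≤ n`), the drift ALLOWS a nonpositive block sum at power `n`: the sequence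
`β0 = (b + A, b, …, b, b − 2A, b, …)` with the dip at index `n` (partial sums `0, b·k + A` for `1 ≤ k ≤ n`, `b·k − A` for `k > n`) satisfies
`OneLoopDrift b A β0` and `blockSum n β0 1 = b·n − 2A ≤ 0`.  So along the tower the power, not a budget, is the price — and it IS a price.
[folklore] -/
theorem drift_allows_nonpos_blockSum {b A : ℝ} (hA : 0 ≤ A) {n : ℕ} (hn : 1 ≤ n) (hbn : b * n ≤ 2 * A) :
    ∃ β0 : ℕ → ℝ, OneLoopDrift b A β0 ∧ blockSum n β0 1 ≤ 0 := by
  classical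
  -- partial sums: S_0 = 0, S_k = b k + A for 1 ≤ k ≤ n, S_k = b k − A for k ≥ n + 1
  let S : ℕ → ℝ := fun k => if k = 0 then 0 else if k ≤ n then b * k + A else b * k - A
  refine ⟨fun j => S (j + 1) - S j, fun k => ?_, ?_⟩
  · have htel : ∑ j ∈ range k, (S (j + 1) - S j) = S k - S 0 := Finset.sum_range_sub S k
    rw [htel]
    simp only [S, if_pos rfl, sub_zero]
    by_cases hk0 : k = 0
    · subst hk0; simp [hA]
    · rw [if_neg hk0]
      by_cases hkn : k ≤ n
      · rw [if_pos hkn]; rw [abs_le]; constructor <;> linarith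
      · rw [if_neg hkn]; rw [abs_le]; constructor <;> linarith
  · have htel : blockSum n (fun j => S (j + 1) - S j) 1 = S (n + n) - S n := by
      unfold blockSum
      have h := Finset.sum_range_sub (fun i => S (n + i)) n
      simp only [add_zero] at h
      rw [← h]
      refine Finset.sum_congr rfl fun i _ => ?_
      simp only [mul_one, add_assoc]
    rw [htel]
    have hn0 : n ≠ 0 := by omega
    have h2n : ¬ (n + n ≤ n) := by omega
    have h2n0 : n + n ≠ 0 := by omega
    simp only [S, if_neg hn0, if_pos le_rfl, if_neg h2n0, if_neg h2n]
    push_cast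
    linarith

/-! ## §2 ENDs on the drift road: no budget along the tower -/

variable {β : HBeta}

/-- **[Balaban1987RG1] THEOREM 2 AS PRINTED FOR THE `L₀ⁿ`-CONSTRUCTION FROM A SMALL-BLOCK DRIFT, NO BUDGET** (every-slope road): forward
generation; a drift `OneLoopDrift b A β0` of the SMALL-block one-loop coefficients with `0 < b` (ANY defect `A`); the power `n ≥ ⌊2A∕b⌋₊ + 1`;
the one-sided one-loop composition hypothesis `hblock : blockSum n β0 k ≤ S.β0 k` (Q-asym1-5, a binder); `EverySlope S γc`, (C), (U) of the
big construction ⟹ `B12.Thm2Printed C L'`.  At a FIXED block size the same drift needs the sharp budget `2A < b`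
(`CapFreeLargeL.thm2Printed_of_drift_oneL` ∕ `drift_allows_nonpos`). [cite: Balaban1987RG1, Thm 2 p.259 with (0.31) and (1.22) p.264] -/
theorem thm2Printed_of_blockTowerDrift_everySlope {C : B12.Construction} (hgen : ForwardGenerated C β) {L' : ℝ} (hL : 1 < L')
    (S : B12Beta.OneLoopSplit β) {β0 : ℕ → ℝ} {n : ℕ} (hblock : ∀ k, blockSum n β0 k ≤ S.β0 k) {b A γc β' : ℝ}
    (h : OneLoopDrift b A β0) (hb : 0 < b) (hn : ⌊2 * A / b⌋₊ + 1 ≤ n)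
    (hrem : EverySlope S γc) (hcont : BetaContH γc β) (hup : BetaUpperH β' γc β) : B12.Thm2Printed C L' := by
  obtain ⟨hpos, hF⟩ := blockSums_of_drift_index_le h hb hn
  exact thm2Printed_of_beta0Floor_everySlope hgen hL S hpos (fun k => (hF k).trans (hblock k)) hrem hcont hup

/-- The same on the LIMIT-FORM road of the big construction. [cite: Balaban1987RG1, Thm 2 p.259 with (0.31) and (1.22) p.264] -/
theorem thm2Printed_of_blockTowerDrift_limitForm (D : Beta.Assembly.LimitForm β) {C : B12.Construction} (hgen : ForwardGenerated C β)
    {L' : ℝ} (hL : 1 < L') {β0 : ℕ → ℝ} {n : ℕ} (hblock : ∀ k, blockSum n β0 k ≤ D.S.β0 k) {b A : ℝ}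
    (h : OneLoopDrift b A β0) (hb : 0 < b) (hn : ⌊2 * A / b⌋₊ + 1 ≤ n) : B12.Thm2Printed C L' := by
  obtain ⟨hpos, hF⟩ := blockSums_of_drift_index_le h hb hn
  exact CapTailSigns.thm2Printed_of_signs D hgen hL fun k _ => hpos.trans_le ((hF k).trans (hblock k))

/-- **IN THE β SUB-CELL'S TYPED CURRENCY — THE WALL STATEMENT GIVES THEOREM-2 GRADE UP THE TOWER**: for ANY step-jet family `Js` on the
coarse torus of side `Lc`, colour parameter `N`, channel `(μ, ν)`: `D1Drift Lc Js N μ ν` (EXIT-A∕B of `OneStepKernelFamily`: partial sums of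
`j ↦ secondMoment (TbalOf Lc Js j) μ ν` within `A` of the line with slope `stepBal N Lc`; OPEN for Bałaban's jets — a binder) and `0 < stepBal N Lc`
(hypothesis `hstep`) ⟹ there is a power `N₁` such that for every `n ≥ N₁` and every big construction (forward generation) whose split dominates
the block sums one-sidedly, with `EverySlope`, (C), (U): `B12.Thm2Printed C L'`.  At a fixed block size the wall gives END grade only
(`OneStepKernelFamily.endpointExistence_of_D1Drift`). [cite: Balaban1987RG1, Thm 2 p.259 with (0.31), (1.22) p.264 and (0.20) p.256] -/
theorem thm2Printed_of_blockTower_D1Drift {Lc : ℕ} [NeZero Lc] {Js : ℕ → JetData 3 Lc} {N : ℝ} {μ ν : Fin 4}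
    (hD : D1Drift Lc Js N μ ν) (hstep : 0 < B12Normalization.stepBal N Lc) :
    ∃ N₁ : ℕ, ∀ n, N₁ ≤ n → ∀ {C : B12.Construction}, ForwardGenerated C β → ∀ (S : B12Beta.OneLoopSplit β),
      (∀ k, blockSum n (fun j => B12Beta.secondMoment (TbalOf Lc Js j) μ ν) k ≤ S.β0 k) →
        ∀ {γc β' L' : ℝ}, EverySlope S γc → BetaContH γc β → BetaUpperH β' γc β → 1 < L' → B12.Thm2Printed C L' := by
  obtain ⟨A, hA⟩ := hD
  exact ⟨⌊2 * A / B12Normalization.stepBal N Lc⌋₊ + 1, fun n hn C hgen S hblock γc β' L' hrem hcont hup hL =>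
    thm2Printed_of_blockTowerDrift_everySlope hgen hL S hblock hA hstep hn hrem hcont hup⟩

/-- Sequence-level form of the wall's tower consequence: `D1Drift Lc Js N μ ν` + `0 < stepBal N Lc` ⟹ SOME power from which on all block
sums of the one-loop coefficients `j ↦ secondMoment (TbalOf Lc Js j) μ ν` are positive. [folklore] -/
theorem exists_towerPower_of_D1Drift {Lc : ℕ} [NeZero Lc] {Js : ℕ → JetData 3 Lc} {N : ℝ} {μ ν : Fin 4}
    (hD : D1Drift Lc Js N μ ν) (hstep : 0 < B12Normalization.stepBal N Lc) :
    ∃ N₁ : ℕ, ∀ n, N₁ ≤ n → ∀ k, 0 < blockSum n (fun j => B12Beta.secondMoment (TbalOf Lc Js j) μ ν) k := by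
  obtain ⟨A, hA⟩ := hD
  exact exists_towerPower_of_drift hA hstep

/-! ## §3 The pinned literal `JsBalAn1`: the tower road's only β-side input is the sign of the limit -/

/-- **AT THE PINNED LITERAL, `0 < lim β⁰_j` ALONE GIVES A CAP-FREE POWER.**  For the β-lead's literal `JsBalAn1` (`2 ≤ Lc`, box root `r`,
colour∕sign constants and an3's table `Tc` by value, any channel `(μ, ν)`), with `b j := secondMoment (TbalOf Lc (JsBalAn1 …) j) μ ν`: the tree's
hypothesis-free all-scales rate (`GAN24.WSlotT2TablesAn1.allScalesSeq_secondMoment_JsBalAn1_pinned`) makes `b` Cauchy at a geometric rate, hence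
`GeomRate b (lim b) (κ∕(1−θ)) θ` (`CauchyRate.geomRate`); so `0 < CauchyRate.lim b` ⟹ `∃ N, ∀ n ≥ N, ∀ k, 0 < blockSum n b k`
(`CapBlockTowerEmpty.blockSums_towerFloor_of_index_le`).  `N` is not a number here (κ, θ sit inside the tree's `∃`).  The hypothesis is the
identification residual of row (D1) in SIGN form only. [folklore] -/
theorem towerPower_of_pinned_limPos {Lc : ℕ} [NeZero Lc] (hLc : 2 ≤ Lc) {r : Fin (3 + 1) → ℕ} (hr : r ∈ box (3 + 1) Lc)
    (cE cVH cΛ cB : ℝ) (Tc : Fin 4 → Fin 4 → Fin 4 → Fin 4 → ℝ) (μ ν : Fin 4)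
    (hlim : 0 < CauchyRate.lim (fun j => B12Beta.secondMoment
        (TbalOf Lc (JsBalAn1 (one_le_of_two_le hLc) hr cE cVH cΛ ((Lc : ℝ) ^ (2 * (3 + 1))) cB Tc) j) μ ν)) :
    ∃ N : ℕ, ∀ n, N ≤ n → ∀ k, 0 < blockSum n (fun j => B12Beta.secondMoment
        (TbalOf Lc (JsBalAn1 (one_le_of_two_le hLc) hr cE cVH cΛ ((Lc : ℝ) ^ (2 * (3 + 1))) cB Tc) j) μ ν) k := by
  obtain ⟨κ, θ, hθ0, hθ1, hall⟩ := allScalesSeq_secondMoment_JsBalAn1_pinned hLc hr cE cVH cΛ cB Tc μ ν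
  have hgeom := hall.cauchyRate.geomRate hθ1
  exact ⟨_, fun n hn k => by
    obtain ⟨hpos, hF⟩ := blockSums_towerFloor_of_index_le hgeom hlim hθ0 hθ1 hn
    exact hpos.trans_le (hF k)⟩

/-- **THEOREM 2 AS PRINTED UP THE TOWER OF THE PINNED LITERAL'S BLOCK SIZE, from the sign of the limit**: `0 < lim_j β⁰_j` for the literal
`JsBalAn1` ⟹ a power `N` such that for every `n ≥ N` and every big construction (forward generation) whose split dominates the block sums of the
literal's coefficients one-sidedly (Q-asym1-5 w.r.t. the literal, a binder), with `EverySlope`, (C), (U): `B12.Thm2Printed C L'`.  No CAP, no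
budget, no certified coefficient; the β-side input is the identification residual of row (D1) in sign form.
[cite: Balaban1987RG1, Thm 2 p.259 with (0.31) and (1.22) p.264] -/
theorem thm2Printed_of_blockTower_pinned {Lc : ℕ} [NeZero Lc] (hLc : 2 ≤ Lc) {r : Fin (3 + 1) → ℕ} (hr : r ∈ box (3 + 1) Lc)
    (cE cVH cΛ cB : ℝ) (Tc : Fin 4 → Fin 4 → Fin 4 → Fin 4 → ℝ) (μ ν : Fin 4)
    (hlim : 0 < CauchyRate.lim (fun j => B12Beta.secondMoment
        (TbalOf Lc (JsBalAn1 (one_le_of_two_le hLc) hr cE cVH cΛ ((Lc : ℝ) ^ (2 * (3 + 1))) cB Tc) j) μ ν)) :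
    ∃ N : ℕ, ∀ n, N ≤ n → ∀ {C : B12.Construction}, ForwardGenerated C β → ∀ (S : B12Beta.OneLoopSplit β),
      (∀ k, blockSum n (fun j => B12Beta.secondMoment
        (TbalOf Lc (JsBalAn1 (one_le_of_two_le hLc) hr cE cVH cΛ ((Lc : ℝ) ^ (2 * (3 + 1))) cB Tc) j) μ ν) k
          ≤ S.β0 k) →
        ∀ {γc β' L' : ℝ}, EverySlope S γc → BetaContH γc β → BetaUpperH β' γc β → 1 < L' → B12.Thm2Printed C L' := by
  obtain ⟨κ, θ, hθ0, hθ1, hall⟩ := allScalesSeq_secondMoment_JsBalAn1_pinned hLc hr cE cVH cΛ cB Tc μ ν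
  have hgeom := hall.cauchyRate.geomRate hθ1
  exact ⟨_, fun n hn C hgen S hblock γc β' L' hrem hcont hup hL => by
    obtain ⟨hpos, hF⟩ := blockSums_towerFloor_of_index_le hgeom hlim hθ0 hθ1 hn
    exact thm2Printed_of_beta0Floor_everySlope hgen hL S hpos (fun k => (hF k).trans (hblock k)) hrem hcont hup⟩

/-! ## §4 The sign of the limit is EXACTLY the β-side content of Theorem 2 up the tower (necessity direction) -/

/-- **NECESSITY UP THE TOWER**: if the big construction's one-loop coefficients ARE the block sums (`hblock` as an EQUALITY — the necessity
direction uses the upper composition inequality too) of a small-block sequence with `GeomRate b β⁰_∞ c₀ θ` (`0 ≤ θ < 1`), `1 ≤ n`, and the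
construction is forward-generated with `EverySlope S γc`, then `B12.Thm2Printed C L'` FORCES `0 < β⁰_∞` (the block sums converge to `n·β⁰_∞`;
gen 3's `CapSignsNecessaryFwd.eventualFloor_of_thm2Printed_tendsto_fwd`).  With `CapBlockTowerEmpty.thm2Printed_of_blockTower_everySlope`:
on the rate road the β-side content of Theorem 2 at every high power is EXACTLY the sign of the limit. [cite: Balaban1987RG1, Thm 2 (0.31) p.259] -/
theorem binf_pos_of_thm2Printed_tower {C : B12.Construction} (hgen : ForwardGenerated C β) (S : B12Beta.OneLoopSplit β) {γc : ℝ}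
    (hrem : EverySlope S γc) {b : ℕ → ℝ} {binf c₀ θ : ℝ} {n : ℕ} (hn : 1 ≤ n) (hblock : ∀ k, S.β0 k = blockSum n b k)
    (hconv : GeomRate b binf c₀ θ) (hθ0 : 0 ≤ θ) (hθ1 : θ < 1) {L' : ℝ} (hL : 1 < L') (h : B12.Thm2Printed C L') : 0 < binf := by
  have hlim : Filter.Tendsto S.β0 Filter.atTop (nhds ((n : ℝ) * binf)) := by
    have h1 := (RateCertificate.geomRate_blockSum hconv n).tendsto (pow_nonneg hθ0 n) (pow_lt_one₀ hθ0 hθ1 (by omega))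
    rw [show S.β0 = blockSum n b from funext hblock]
    exact h1
  have hpos := (CapSignsNecessaryFwd.eventualFloor_of_thm2Printed_tendsto_fwd hgen S hrem hlim hL h).1
  have hnpos : (0 : ℝ) < n := by exact_mod_cast hn
  by_contra hle
  have : (n : ℝ) * binf ≤ 0 := mul_nonpos_of_nonneg_of_nonpos hnpos.le (not_lt.mp hle)
  linarith

/-- **THE IFF AT A HIGH POWER** (rate road, `hblock` as an equality): for `n ≥ ⌊c₀∕((1−θ)β⁰_∞)⌋₊ + 1` (a vacuous-free condition for every
real `β⁰_∞`), a forward-generated big construction with `EverySlope`, (C), (U): `B12.Thm2Printed C L' ↔ 0 < β⁰_∞`. [cite: Balaban1987RG1, Thm 2 (0.31) p.259] -/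
theorem thm2Printed_tower_iff_binf_pos {C : B12.Construction} (hgen : ForwardGenerated C β) {L' : ℝ} (hL : 1 < L')
    (S : B12Beta.OneLoopSplit β) {b : ℕ → ℝ} {n : ℕ} (hblock : ∀ k, S.β0 k = blockSum n b k) {binf c₀ θ γc β' : ℝ}
    (hconv : GeomRate b binf c₀ θ) (hθ0 : 0 ≤ θ) (hθ1 : θ < 1) (hn : ⌊c₀ / ((1 - θ) * binf)⌋₊ + 1 ≤ n)
    (hrem : EverySlope S γc) (hcont : BetaContH γc β) (hup : BetaUpperH β' γc β) : B12.Thm2Printed C L' ↔ 0 < binf :=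
  ⟨binf_pos_of_thm2Printed_tower hgen S hrem (le_trans (Nat.le_add_left 1 _) hn) hblock hconv hθ0 hθ1 hL,
    fun hbinf => CapBlockTowerEmpty.thm2Printed_of_blockTower_everySlope hgen hL S hblock hconv hbinf hθ0 hθ1 hn hrem hcont hup⟩

/-- **AT THE PINNED LITERAL, NECESSITY**: for ANY power `n ≥ 1`, a forward-generated big construction whose one-loop coefficients ARE the block
sums of the literal's `j ↦ β⁰_j` (`hblock` as an equality), with `EverySlope`: `B12.Thm2Printed C L'` forces `0 < CauchyRate.lim (j ↦ β⁰_j)`.  With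
`towerPower_of_pinned_limPos` ∕ `thm2Printed_of_blockTower_pinned`: at the pinned literal the β-side content of Theorem 2 up the tower is
EXACTLY the sign of the limit. [cite: Balaban1987RG1, Thm 2 (0.31) p.259] -/
theorem limPos_of_thm2Printed_pinned {Lc : ℕ} [NeZero Lc] (hLc : 2 ≤ Lc) {r : Fin (3 + 1) → ℕ} (hr : r ∈ box (3 + 1) Lc)
    (cE cVH cΛ cB : ℝ) (Tc : Fin 4 → Fin 4 → Fin 4 → Fin 4 → ℝ) (μ ν : Fin 4)
    {C : B12.Construction} (hgen : ForwardGenerated C β) (S : B12Beta.OneLoopSplit β) {γc : ℝ} (hrem : EverySlope S γc)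
    {n : ℕ} (hn : 1 ≤ n)
    (hblock : ∀ k, S.β0 k = blockSum n (fun j => B12Beta.secondMoment
        (TbalOf Lc (JsBalAn1 (one_le_of_two_le hLc) hr cE cVH cΛ ((Lc : ℝ) ^ (2 * (3 + 1))) cB Tc) j) μ ν) k)
    {L' : ℝ} (hL : 1 < L') (h : B12.Thm2Printed C L') :
    0 < CauchyRate.lim (fun j => B12Beta.secondMoment
        (TbalOf Lc (JsBalAn1 (one_le_of_two_le hLc) hr cE cVH cΛ ((Lc : ℝ) ^ (2 * (3 + 1))) cB Tc) j) μ ν) := by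
  obtain ⟨κ, θ, hθ0, hθ1, hall⟩ := allScalesSeq_secondMoment_JsBalAn1_pinned hLc hr cE cVH cΛ cB Tc μ ν
  exact binf_pos_of_thm2Printed_tower hgen S hrem hn hblock (hall.cauchyRate.geomRate hθ1) hθ0 hθ1 hL h

end

end Summit.QuantumFields.BalabanUV.Gaps.CapBlockTowerDrift
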